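import Summits.QuantumFields.YangMills.Theorems.BalabanUVNodesPortS1Sect5ChartSymmetry
import Summits.QuantumFields.YangMills.Theorems.BalabanUVNodesPortS1Sect5EuclOnAx

/-!
# NODE O port, row PT-A-2 S5-A CAPSTONE — [Balaban1987RG1] (5.7) and (5.8)₂ FOR THE RE-CENTRED RECORD'S LIMITING KERNEL `recordPlimAx` FROM N09-SHAPE ROWS ONLY:
# the τ∕c_ρ hypotheses of `…Sect5ChartSymmetry.recordPlimAx_symmetries_of_local` DISCHARGED by `…Sect5EuclOnAx.mergedTermT_{translate,creflect}_on_recordAx`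

CITATION HEADER.  [I] = [Balaban1987RG1]: (5.2)–(5.4) p. 292, (5.7)–(5.8) p. 293, (1.21) p. 264, (2.17)–(2.18) p. 269, p. 263; [B11] = [Balaban1985Variational] Thm 1 p. 279.
Porter PT-A-2 (`ymgap-nodeO-port-PTA-2`), `--supports stmt-QuantumFields-27930 --as helper`.  DISPLAYED ROWS (every one an N09 shape or a def-B property, asserted nowhere),
for all large volumes `K`: [B11] Thm 1 on the small-field domains of levels `≤ k+1` at the cut-off's radius `ν.εreg`; (F7a) «`domAlt_{j+1} ⊆ regSet_j(ρ_j)`»; (F7a-supp)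
«`χ^{Ax}_j = 0` off `domAlt_j` a.e. over the fibres of `domAlt_{j+1}`»; (I19) integrability; the NESTING «`Ū^k U_{k+1}(W) ∈ domAlt_k`» and [B11] at radius `εbg` for
`W ∈ domAlt_{k+1}`; `PolLimitExists` for the family; `C²` at `0` of its chart; positivity of the domain's plaquette threshold `ν.ε₀`.
WHAT IS PROVED (0 sorry, 0 def): ★ `indexSymmetric_reflCovariant_recordPlimAx_of_rows` — `IndexSymmetric (recordPlimAx F a₀ ε₂₉ k v) ∧ ReflCovariant (recordPlimAx F a₀ ε₂₉ k v)`
((5.8)₂ and (5.7) at the record; (5.6) keeps its π-row, which needs FILE E2's Federbush-admissibility clause — `recordPlimAx_symmetries_of_local`).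
HONEST FRAMING.  Bookkeeping; nothing of Bałaban's estimates asserted, ported or discharged; 27930 signed-open (⁸-Ax-LR4), no claim held; finite 𝕋⁴ at fixed ε — NOT continuum∕OS∕Clay;
the Yang–Mills mass gap is NOT proved by any of this.
-/

noncomputable section

open scoped Matrix.Norms.L2Operator Topology

namespace Summit.QuantumFields.YangMills.Theorems.BalabanUVNodesPortS1

open Filter MeasureTheory
open Literature.MathematicalPhysics.QuantumFieldTheory.Balaban1983to89
open Literature.MathematicalPhysics.QuantumFieldTheory.Balaban1983to89.Node00
open T4Continuum (T4Family)
open Summit.QuantumFields.YangMills.Theorems.K0RecordFormatNames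
open B12PolarizationTensor120 (expChart)

variable (F : T4Family) (a₀ ε₂₉ : ℝ)

/-- **★ (5.7) AND (5.8)₂ FOR `recordPlimAx F a₀ ε₂₉ k v` FROM N09-SHAPE ROWS**: with `θ := thetaFill F a₀ ε₂₉`, `g := extd v`, if `0 < θ.ν.ε₀`, the limit (1.21) exists, and for
all large `K`: the chart is `C²` at `0`, `k + 1 ≤ K`, [B11] on the domains (radius `ν.εreg`, levels `≤ k+1`), (F7a), (F7a-supp), (I19), and for every `W ∈ domAlt_{k+1}` the
nesting `Ū^k U_{k+1}(W) ∈ domAlt_k` and [B11] at radius `θ.εbg` — then the record's limiting kernel is index-symmetric and reflection covariant.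
[cite: Balaban1987RG1, (5.7)-(5.8) p.293, (5.2)-(5.4) p.292, (2.17)-(2.18) p.269, (1.21) p.264; Balaban1985Variational, Thm 1 p.279] -/
theorem indexSymmetric_reflCovariant_recordPlimAx_of_rows (k : ℕ) (v : Fin (k + 1) → ℝ)
    (hε₀ : 0 < (thetaFill F a₀ ε₂₉).ν.ε₀)
    (hlim : letI θ := thetaFill F a₀ ε₂₉
      letI := θ.instVβ₁; letI := θ.instVβ₂; letI := θ.instιβ
      PolLimitExists F (k + 1) (fun K => recordTermsAx F a₀ ε₂₉ k v K) θ.ρ8 θ.bV)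
    (hC2 : letI θ := thetaFill F a₀ ε₂₉
      letI := θ.instVβ₁; letI := θ.instVβ₂
      ∀ᶠ K in atTop, ContDiffAt ℝ 2 (expChart (recordTermsAx F a₀ ε₂₉ k v K) θ.ρ8) 0)
    (hrows : letI θ := thetaFill F a₀ ε₂₉
      ∀ᶠ K in atTop, k + 1 ≤ K ∧
        (∀ j < k + 1, ∀ W ∈ domAltOfRecord F 2 θ.ν K (j + 1), UkExists F 2 K (j + 1) θ.ν.εreg W ∧ UniqueUkOrbit F 2 K (j + 1) θ.ν.εreg W) ∧
        (∀ j < k + 1, domAltOfRecord F 2 θ.ν K (j + 1) ⊆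
          regSetOfRecord F 2 K j (betaInputOfRecord F 2 (TβOfRecord₁₃ F 2) (chiβOfRecord₁₃Ax F 2 θ) K (T4FlagMemory.extd v) j)) ∧
        (∀ j < k + 1, ∀ᵐ U ∂(fieldMeasure (F.P K) j (SU 2)), (avOfRecord F 2 K j).avg U ∈ domAltOfRecord F 2 θ.ν K (j + 1) →
          U ∉ domAltOfRecord F 2 θ.ν K j → chiβOfRecord₁₃Ax F 2 θ K (T4FlagMemory.extd v) j U = 0) ∧
        (∀ j < k + 1, Integrable (betaInputOfRecord F 2 (TβOfRecord₁₃ F 2) (chiβOfRecord₁₃Ax F 2 θ) K (T4FlagMemory.extd v) j) (fieldMeasure (F.P K) j (SU 2))) ∧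
        (∀ W ∈ domAltOfRecord F 2 θ.ν K (k + 1),
          Averaging.iter (avOfRecord F 2 K) k (Uk F 2 K (k + 1) θ.εbg W) ∈ domAltOfRecord F 2 θ.ν K k ∧
            UkExists F 2 K (k + 1) θ.εbg W ∧ UniqueUkOrbit F 2 K (k + 1) θ.εbg W)) :
    Beta.PolarizationSign.IndexSymmetric (recordPlimAx F a₀ ε₂₉ k v) ∧ B12Transverse536.ReflCovariant (recordPlimAx F a₀ ε₂₉ k v) := by
  letI θ := thetaFill F a₀ ε₂₉; letI := θ.instVβ₁; letI := θ.instVβ₂; letI := θ.instιβ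
  refine indexSymmetric_reflCovariant_polLimit_of_local F (k + 1) (fun K => recordTermsAx F a₀ ε₂₉ k v K) θ.ρ8 θ.bV hlim hC2 ?_ ?_
  · filter_upwards [hrows] with K hK
    obtain ⟨hk, h11, hF7a, hsupp, hint, htop⟩ := hK
    intro a
    refine expChart_recordTermsAx_eventuallyEq_of a₀ ε₂₉ k v K _ (recordΦfAx_translate_eventuallyEq a₀ ε₂₉ k v K hε₀ a fun W hW => ?_)
    have hWD : W ∈ domAltOfRecord F 2 θ.ν K (k + 1) := (mem_domAltOfRecord_iff F 2 θ.ν K (k + 1) W).2 hW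
    have hWa : W.translate a ∈ domAltOfRecord F 2 θ.ν K (k + 1) := (translate_mem_domAltOfRecord_iff K θ.ν (k + 1) a W).2 hWD
    exact mergedTermT_translate_on_recordAx θ K (T4FlagMemory.extd v) θ.εbg hk a h11 hF7a hsupp hint hWD (htop W hWD).1 (htop W hWD).2.1 (htop _ hWa).2.2
  · filter_upwards [hrows] with K hK
    obtain ⟨hk, h11, hF7a, hsupp, hint, htop⟩ := hK
    intro ρ'
    refine expChart_recordTermsAx_eventuallyEq_of a₀ ε₂₉ k v K _ (recordΦfAx_creflect_eventuallyEq a₀ ε₂₉ k v K hε₀ ρ' fun W hW => ?_)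
    have hWD : W ∈ domAltOfRecord F 2 θ.ν K (k + 1) := (mem_domAltOfRecord_iff F 2 θ.ν K (k + 1) W).2 hW
    have hWr : W.creflect ρ' ∈ domAltOfRecord F 2 θ.ν K (k + 1) := (creflect_mem_domAltOfRecord_iff K θ.ν (k + 1) ρ' W).2 hWD
    exact mergedTermT_creflect_on_recordAx θ K (T4FlagMemory.extd v) θ.εbg hk ρ' h11 hF7a hsupp hint hWD (htop W hWD).1 (htop W hWD).2.1 (htop _ hWr).2.2

end Summit.QuantumFields.YangMills.Theorems.BalabanUVNodesPortS1

end
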